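import Mathlib.Analysis.SpecialFunctions.Pow.Real
import Mathlib.Analysis.SpecialFunctions.Log.Basic
import Mathlib.Analysis.Complex.ExponentialBounds
import HarnessLib

/-!
# [GenEll] Lemma 3.7, case (a): the real-number core of the printed proof

S. Mochizuki, *Arithmetic elliptic curves in general position*, Math. J. Okayama Univ. **52** (2010),
Lemma 3.7 and its proof, pp. 18–19 [cite: MochizukiGenEll2010, Lem 3.7 p.18].  Case (a) of the lemma
("`l ≥ 100d·(ht_Falt([E_L]) + C·d^ε)` and `E_L` has a prime of multiplicative reduction") is, once the
four inputs are named, an exercise in real inequalities; this file proves exactly that exercise, with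
the inputs as hypotheses on real numbers (`d = [L:ℚ] ≥ 1`, `D = deg_∞([E_L]) ≥ 0`, `h = ht_Falt([E_L])`,
`l` the prime, `v` a local height):

* Prop. 3.4 with "`12(1+ε)`" taken to be `14`: `D ≤ 14·h + K` (`K ≥ 0` the BD-constant);
* Lemma 3.5 (†): `(l/14)·D ≤ h + 2·log l + C'` (when `E_L` admits an `l`-cyclic subgroup scheme);
* Lemma 3.6: `y ≥ 1`, `x ≥ C₀·y^{1+ε}` ⇒ `x ≥ y·log x`;
* "`d·deg_∞ ≥ v·log 2`" for every local height `v` (`GenEllMellLocalHeight.lean`), and `d·D ≥ log 2` when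
  there is a prime of multiplicative reduction (some local height is `≥ 1`).

Conclusions (`lemma37a_core`): a constant `C > 0` (depending on `K, C₀, ε`) and a bound `B` (depending on
`C'`) such that under `l ≥ 100 d (h + C d^ε)`: every local height is `< l` (printed: "`l ≥ (100d/14)·deg_∞
≥ (100·log 2/14)·v > v`"), and if moreover (†) holds and `d·D ≥ log 2` then `h ≤ B` (printed: "`l·log 2/(28d)
≤ ht_Falt + C'` … `2·ht_Falt ≤ ht_Falt + C'`", here with the honest factor `100·log 2/28 > 2`).  The
assembly with the tree's `EllPoint` vocabulary and the named fact `GenEll_lemma35` is done in the companion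
of abc-iut-S4's statement file.  Mathlib only; theorems only.
-/

namespace Literature.NumberTheory.DiophantineGeometry.GenEll

namespace Lemma37

open Real

/-- `log 2 > 1/2` (we use `100·log 2/14 > 1` and `100·log 2/28 > 2`). [folklore] -/
private theorem half_lt_log_two : (1 : ℝ) / 2 < Real.log 2 := by
  have := Real.log_two_gt_d9
  linarith

/-- **[GenEll] Lemma 3.7, case (a), first conclusion** ("`l` is `>` the local heights"): if
`D ≤ 14h + K`, `K ≥ 0`, `C ≥ K/14`, `d ≥ 1`, `ε`-free part: `l ≥ 100·d·(h + C·d^ε)` with `d^ε ≥ 1`, and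
`v·log 2 ≤ d·D`, then `v < l`. [cite: MochizukiGenEll2010, Lem 3.7 p.18] -/
theorem local_height_lt {K C d dε D h l v : ℝ} (hK : 0 ≤ K) (hC : K / 14 ≤ C) (hd : 1 ≤ d)
    (hdε : 1 ≤ dε) (hD : D ≤ 14 * h + K) (hl : 100 * d * (h + C * dε) ≤ l) (hlpos : 0 < l)
    (hv : v * Real.log 2 ≤ d * D) : v < l := by
  have hlog := half_lt_log_two
  have hlog1 : Real.log 2 ≤ 1 := by
    have := Real.log_two_lt_d9; linarith
  by_cases hv0 : v ≤ 0
  · linarith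
  push Not at hv0
  -- `h + C·dε ≥ h + K/14 ≥ (14h + K)/14 ≥ D/14`
  have h1 : h + K / 14 ≤ h + C * dε := by nlinarith
  have h2 : D ≤ 14 * (h + C * dε) := by linarith
  -- `v·log 2 ≤ d·D ≤ 14 d (h + C dε) ≤ (14/100)·l`
  have h3 : d * D ≤ d * (14 * (h + C * dε)) := mul_le_mul_of_nonneg_left h2 (by linarith)
  nlinarith

/-- **[GenEll] Lemma 3.7, case (a), second conclusion** (the exceptional set): with the constants as in
the printed proof — `K ≥ 0` (Prop. 3.4), `C₀ > 0` with the Lemma 3.6 property for the exponent `ε`,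
`C ≥ K/14` and `100·(C − K/14) ≥ C₀·(56/log 2)^{1+ε}` — if `d ≥ 1`, `D ≤ 14h + K`,
`l ≥ 100·d·(h + C·d^ε)`, the Lemma 3.5 inequality (†) `(l/14)·D ≤ h + 2·log l + C'` holds and `E_L` has a
prime of multiplicative reduction (`log 2 ≤ d·D`), then `h ≤ max 0 (C'/ (100·log 2/28 − 1))`, a bound
independent of `E_L`, `L`, `l`. [cite: MochizukiGenEll2010, Lem 3.7 p.18] -/
theorem htFalt_le {ε K C₀ C C' d D h l : ℝ} (hε : 0 < ε) (hK : 0 ≤ K) (hC₀ : 0 < C₀)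
    (h36 : ∀ x y : ℝ, 1 ≤ y → C₀ * y ^ (1 + ε) ≤ x → y * Real.log x ≤ x)
    (hC : K / 14 ≤ C) (hC' : C₀ * (56 / Real.log 2) ^ (1 + ε) ≤ 100 * (C - K / 14))
    (hd : 1 ≤ d) (hD : D ≤ 14 * h + K) (hDnn : 0 ≤ D) (hl : 100 * d * (h + C * d ^ ε) ≤ l)
    (hdag : l / 14 * D ≤ h + 2 * Real.log l + C') (hmult : Real.log 2 ≤ d * D) :
    h ≤ max 0 (C' / (100 * Real.log 2 / 28 - 1)) := by
  have hlog := half_lt_log_two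
  have hlog0 : 0 < Real.log 2 := by linarith
  have hd0 : 0 < d := by linarith
  have hdε : 1 ≤ d ^ ε := Real.one_le_rpow hd hε.le
  -- `h ≥ -K/14` from `0 ≤ D ≤ 14 h + K`
  have hhK : -K / 14 ≤ h := by linarith
  -- Step 1: `l ≥ 100 (C - K/14) d^{1+ε} ≥ C₀ (56 d / log 2)^{1+ε}`
  have hy : 1 ≤ 56 * d / Real.log 2 := by
    rw [le_div_iff₀ hlog0]
    have : Real.log 2 ≤ 1 := by have := Real.log_two_lt_d9; linarith
    nlinarith
  have hl1 : 100 * (C - K / 14) * d ^ (1 + ε) ≤ l := by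
    have e1 : d ^ (1 + ε) = d * d ^ ε := by
      rw [Real.rpow_add hd0, Real.rpow_one]
    rw [e1]
    have : (C - K / 14) * d ^ ε ≤ h + C * d ^ ε := by nlinarith
    nlinarith
  have hl2 : C₀ * (56 * d / Real.log 2) ^ (1 + ε) ≤ l := by
    have e2 : (56 * d / Real.log 2) ^ (1 + ε) = (56 / Real.log 2) ^ (1 + ε) * d ^ (1 + ε) := by
      rw [show 56 * d / Real.log 2 = 56 / Real.log 2 * d by ring]
      exact Real.mul_rpow (by positivity) hd0.le
    rw [e2, ← mul_assoc]
    have hdpow : 0 ≤ d ^ (1 + ε) := by positivity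
    calc C₀ * (56 / Real.log 2) ^ (1 + ε) * d ^ (1 + ε) ≤ 100 * (C - K / 14) * d ^ (1 + ε) :=
          mul_le_mul_of_nonneg_right hC' hdpow
      _ ≤ l := hl1
  -- Step 2 (Lemma 3.6): `(56 d / log 2) log l ≤ l`, i.e. `2 log l ≤ l log 2 / (28 d)`
  have h36' := h36 l (56 * d / Real.log 2) hy hl2
  have hlogl : 2 * Real.log l ≤ l * Real.log 2 / (28 * d) := by
    rw [le_div_iff₀ (by positivity)]
    have : 56 * d / Real.log 2 * Real.log l * Real.log 2 ≤ l * Real.log 2 :=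
      mul_le_mul_of_nonneg_right h36' hlog0.le
    have e3 : 56 * d / Real.log 2 * Real.log l * Real.log 2 = 56 * d * Real.log l := by
      field_simp
    linarith
  -- Step 3: from (†) and `D ≥ log 2 / d`: `l log 2 / (28 d) ≤ h + C'`
  have hl0 : 0 < l := by
    have : 0 < C₀ * (56 * d / Real.log 2) ^ (1 + ε) := by positivity
    linarith
  have hstep : l * Real.log 2 / (14 * d) ≤ l / 14 * D := by
    rw [div_le_iff₀ (by positivity)]
    have : l * Real.log 2 ≤ l * (d * D) := mul_le_mul_of_nonneg_left hmult hl0.le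
    nlinarith
  have hkey : l * Real.log 2 / (28 * d) ≤ h + C' := by
    have e4 : l * Real.log 2 / (14 * d) = 2 * (l * Real.log 2 / (28 * d)) := by
      field_simp; ring
    linarith
  -- Step 4: `l ≥ 100 d (h + C d^ε) ≥ 100 d (h + K/14) ≥ 100 d h⁺`-type bound ⇒ `h` bounded
  have hq : 0 < 100 * Real.log 2 / 28 - 1 := by nlinarith
  rcases le_or_gt h 0 with hh0 | hh0
  · exact hh0.trans (le_max_left _ _)
  · -- `l ≥ 100 d h` (as `C d^ε ≥ 0`)
    have hCnn : 0 ≤ C := by have := div_nonneg hK (by norm_num : (0:ℝ) ≤ 14); linarith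
    have hl3 : 100 * d * h ≤ l := by
      have e : 100 * d * (h + C * d ^ ε) = 100 * d * h + 100 * d * (C * d ^ ε) := by ring
      have : 0 ≤ 100 * d * (C * d ^ ε) := by positivity
      linarith
    have h5 : 100 * d * h * Real.log 2 / (28 * d) ≤ h + C' := by
      have : 100 * d * h * Real.log 2 / (28 * d) ≤ l * Real.log 2 / (28 * d) := by
        apply div_le_div_of_nonneg_right _ (by positivity)
        exact mul_le_mul_of_nonneg_right hl3 hlog0.le
      linarith
    have e5 : 100 * d * h * Real.log 2 / (28 * d) = (100 * Real.log 2 / 28) * h := by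
      field_simp
    rw [e5] at h5
    have h6 : (100 * Real.log 2 / 28 - 1) * h ≤ C' := by linarith
    have h7 : h ≤ C' / (100 * Real.log 2 / 28 - 1) := by
      rw [le_div_iff₀ hq]; linarith
    exact h7.trans (le_max_right _ _)

/-- **[GenEll] Lemma 3.7, case (b), with an `l`-cyclic subgroup scheme** (the last paragraph of the
printed proof, p. 19): inputs — (†) of Lemma 3.5 with "`12(1+ε)`" `= 14`, `(l/14)·D ≤ h + 2·log l + C'`;
Prop. 3.4, `deg_∞ ≤ ht_∞` and `12(1+δ)·ht_Falt ≤ (1+δ)·ht_∞ + K₂`; and the compactly-bounded input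
"`ht_∞ − deg_∞` is bounded on `K_V`", `H ≤ D + A`.  Conclusion: `ht_∞ = H` is bounded by a constant
depending only on `A, K₂, C'` — for EVERY prime `l ≥ 2` (the printed shortcut "since we may assume `l ≥ 5`"
is replaced by the estimate `l/14 − 1/12 ≥ 5l/168`, so no lower bound on `l` beyond `2` is needed).
[cite: MochizukiGenEll2010, Lem 3.7 p.19] -/
theorem htInf_le {δ K₂ A C' D H h l : ℝ} (hδ : 0 ≤ δ) (hK₂ : 0 ≤ K₂) (hl : 2 ≤ l) (hD0 : 0 ≤ D)
    (hHA : H ≤ D + A) (h34 : 12 * (1 + δ) * h ≤ (1 + δ) * H + K₂)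
    (hdag : l / 14 * D ≤ h + 2 * Real.log l + C') :
    H ≤ 168 / 5 * (max 0 (A / 12 + K₂ / 12 + C') / 2 + 2) + A := by
  set M : ℝ := A / 12 + K₂ / 12 + C' with hM
  have hl0 : 0 < l := by linarith
  -- `h ≤ (D + A)/12 + K₂/12`
  have h1 : h ≤ (D + A) / 12 + K₂ / 12 := by
    have hδ1 : 0 < 1 + δ := by linarith
    have : 12 * h ≤ H + K₂ / (1 + δ) := by
      rw [show H + K₂ / (1 + δ) = ((1 + δ) * H + K₂) / (1 + δ) by field_simp]
      rw [le_div_iff₀ hδ1]; linarith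
    have hK' : K₂ / (1 + δ) ≤ K₂ := div_le_self hK₂ (by linarith)
    linarith
  -- `2 log l ≤ 2 l`
  have h2 : 2 * Real.log l ≤ 2 * l := by
    have := Real.log_le_sub_one_of_pos hl0; linarith
  -- `(l/14 - 1/12) D ≤ M + 2 l` and `l/14 - 1/12 ≥ 5 l / 168`
  have h3 : (5 * l / 168) * D ≤ M + 2 * l := by
    have e : (l / 14 - 1 / 12) * D ≤ M + 2 * l := by rw [hM]; nlinarith
    have hcoef : 5 * l / 168 ≤ l / 14 - 1 / 12 := by linarith
    nlinarith
  -- divide by `5l/168 > 0`: `D ≤ (168/5)(M/l + 2) ≤ (168/5)(M⁺/2 + 2)`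
  have hM' : M ≤ max 0 M := le_max_right _ _
  have hMp : 0 ≤ max 0 M := le_max_left _ _
  have h4 : D ≤ 168 / 5 * (max 0 M / 2 + 2) := by
    have h4a : 5 * l / 168 * D ≤ max 0 M + 2 * l := by linarith
    -- `max 0 M ≤ (max 0 M / 2) * l` since `l ≥ 2`
    have h4b : max 0 M ≤ max 0 M / 2 * l := by nlinarith
    have h4c : 5 * l / 168 * D ≤ (max 0 M / 2 + 2) * l := by linarith
    have h4d : 5 / 168 * D ≤ max 0 M / 2 + 2 :=
      le_of_mul_le_mul_right (show (5 / 168 * D) * l ≤ (max 0 M / 2 + 2) * l by linarith) hl0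
    linarith
  linarith

end Lemma37

end Literature.NumberTheory.DiophantineGeometry.GenEll
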